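/-
Copyright: cell pub-balaban-gaps, seat ne8 (estimate NE7c), gen 13. Project licence.
-/
import Summits.QuantumFields.BalabanUV.T4Continuum.Spine.NE7b.CompactFibreWindowSUNRate
import Summits.QuantumFields.BalabanUV.T4Continuum.Spine.NE7c.LiveFactorWindowRate

/-!
# Road (δ) on the `SU(N)` window-volume letter AT PRINT'S RATE `½d(𝔤) = ½(N² − 1)`, ALL `N` (ne6's V29): at a live window the RATE is
# ASSIGNMENT-FREE on both sides and the soft constant absorbs `(N² − 1)·log ν₀⁻¹` (Hilbert–Schmidt window) ∕ `½(N² − 1)·log ν₀⁻¹` (trace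
# window) per bond — ONE constant for the grid (row NE7c; junction J-15, the all-`N` twin of file 27 §1)

Cell `pub-balaban-gaps` (G2), seat ne8, estimate **NE7c** (`T4IndicatorShell.ShellWeightBound`; two-run artefact, NOT PRINTED in
[Bałaban 1983–89], NOT PROVED).  Twenty-ninth proof-only file under `Spine/NE7c/`: seat ne6 GEN 15's census file V29
`Spine/NE7b/CompactFibreWindowSUNRate` (the window-volume letter of the `SU(N)` model for ALL `N` at print's rate, from the tree's two-sided
small-ball law `HaarSmallBallTwoSided`: `|−log κ(Π_b SB η) − #bonds·(N² − 1)·log η⁻¹| ≤ #bonds·c`, soft `c`) consumed BY NAME at road (δ)'s live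
letters; imports that file and this seat's file 27 `LiveFactorWindowRate` (§0: `rate_mul_log_inv_mul_le`, `log_inv_le_log_inv_mul`).  Nothing of
Bałaban's is named; no `def`; 0 `sorry`.

THE QUESTION (seat census `HOME/ne/NE7c.md` §20, row 47 (i) for the headline's group).  File 27 read the `SU(2)` letter (rate `3∕2`, explicit
constants `160`, `12`) at a live window `W_{νη}`, `ν ∈ [ν₀, 1]`: rate assignment-free, constant shifted by `(3∕2)log ν₀⁻¹`.  V29 states the
letter for every `N` with a SOFT constant (`∃ c ≥ 0, ∀ 0 < η ≤ 2, …`).  Does the live factor still sit in the constant only, uniformly over the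
grid of assignments, for every `N`?

WHAT IS PROVED ([folklore]; V29's existential letters BY NAME at `η := νη` plus file 27 §0):
* §1 Hilbert–Schmidt window `SB η = {V : SU(N) | ‖V − 1‖_HS ≤ η}` of a region (product Haar on `bonds → SU(N)`):
  **`exists_abs_neg_log_pi_sball_sub_le_live`** — for every `0 < ν₀ ≤ 1` there is ONE `c′ ≥ 0` (namely V29's `c` plus `(N² − 1)·log ν₀⁻¹`)
  with, for all `0 < η ≤ 2` and all `ν ∈ [ν₀, 1]`: positive mass and `|−log κ(Π_b SB (νη)) − #bonds·(N² − 1)·log η⁻¹| ≤ #bonds·c′` — the RATE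
  `N² − 1 = dim SU(N)` (in the radius) is assignment-free, the live factor sits in the constant; `exists_neg_log_pi_sball_le_sharp_live` (the
  price form `−log κ(Π_b SB (νη)) ≤ #bonds·((N² − 1)·log η⁻¹ + c′)`).
* §2 trace (action) window `{Re tr(1 − V) ≤ t}` — print's rate `½d(𝔤) = ½(N² − 1)` in `t`:
  **`exists_abs_neg_log_pi_traceWindow_sub_le_live`** — ONE `c′ = c + ½(N² − 1)·log ν₀⁻¹` with
  `|−log κ(Π_b {Re tr(1 − V_b) ≤ νt}) − #bonds·½(N² − 1)·log t⁻¹| ≤ #bonds·c′` for all `0 < t ≤ 2`, `ν ∈ [ν₀, 1]`.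
* §3 sanity: `N = 2` recovers file 27's shape of the constant shift (`(2² − 1)∕2 = 3∕2`).

CENSUS (row 47 (i), all `N`; `HOME/ne/NE7c.md` §20): the RATE `½d(𝔤)` of [Balaban1989LargeFieldII] (1.10)'s letter is ASSIGNMENT-FREE under
road (δ) for the headline's group `SU(N)`, every `N`; the live factor moves the (soft) constant by `½d(𝔤)·log ν₀⁻¹` per degree of freedom —
bounded, `k`-uniform, ONE constant for the grid (`ν₀, λ₀` are road (δ)'s fixed numbers, chosen once).  MILD.  BY-NAME EFFECT ON THE WALL: none.

NOT HERE (honest): V29's junction `exists_compactFibre_moment_le_SUNwindow_sharp` at a live window — one application with `c′` in place of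
`c`; the constants by value for `N ≥ 3` (V29's are soft: the tree's compactness constants); which window Bałaban's step carries ((A3) ∕ (A1c),
NC-NE7b-α UNRULED); node O; NE7c.  VERDICT WORD UNCHANGED: WORK-bound behind node O; INSTANCE 0∕1.  NE7c ∕ NE7b NOT PRINTED ∕ NOT PROVED;
spine 0∕9; one finite T⁴ — NOT ℝ⁴, NOT infinite volume, NOT the mass gap, NOT Clay.
HONEST DEPENDENCY (cell): continuum YM on T⁴ ⇐ BetaPertH ∧ nine spine estimates (0∕9 proved); BetaPertH ⇐ (D1) ∧ (D4) ∧ CAP+tail.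
-/

set_option autoImplicit false

noncomputable section

open MeasureTheory Real Finset
open Literature.MathematicalPhysics.QuantumFieldTheory (haarProbability)
open Summit.QuantumFields.BalabanUV.T4Continuum.NE7b.CompactFibreWindowSUNRate
open Summit.QuantumFields.BalabanUV.T4Continuum.Spine.NE7c.LiveFactorWindowRate (rate_mul_log_inv_mul_le log_inv_le_log_inv_mul)

namespace Summit.QuantumFields.BalabanUV.T4Continuum.Spine.NE7c.LiveFactorWindowRateSUN

variable {N : ℕ}

/-! ## §0 The live pin from a dead pin: one line of arithmetic, any rate `d ≥ 0` -/

/-- **A TWO-SIDED PIN AT RATE `d` SURVIVES A LIVE FACTOR WITH ITS CONSTANT SHIFTED**: if `|X − n·(d·log (νη)⁻¹)| ≤ n·c` then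
`|X − n·(d·log η⁻¹)| ≤ n·(c + d·log ν₀⁻¹)` for `0 < ν₀ ≤ ν ≤ 1`, `η > 0`, `d, n ≥ 0`. [folklore] -/
theorem abs_pin_live {X n d c η ν ν₀ : ℝ} (hn : 0 ≤ n) (hd : 0 ≤ d) (hν₀ : 0 < ν₀) (hν : ν₀ ≤ ν) (hν1 : ν ≤ 1) (hη : 0 < η)
    (h : |X - n * (d * Real.log (ν * η)⁻¹)| ≤ n * c) :
    |X - n * (d * Real.log η⁻¹)| ≤ n * (c + d * Real.log ν₀⁻¹) := by
  have hνpos : 0 < ν := hν₀.trans_le hν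
  have h1 := mul_le_mul_of_nonneg_left (rate_mul_log_inv_mul_le hd hν₀ hν hη) hn
  have h2 := mul_le_mul_of_nonneg_left (mul_le_mul_of_nonneg_left (log_inv_le_log_inv_mul hνpos hν1 hη) hd) hn
  have hlog : 0 ≤ Real.log ν₀⁻¹ := by
    rw [Real.log_inv]; linarith [Real.log_nonpos hν₀.le (hν.trans hν1)]
  have h3 : 0 ≤ n * (d * Real.log ν₀⁻¹) := by positivity
  rw [abs_le] at h ⊢
  obtain ⟨hl, hu⟩ := h
  constructor <;> linarith

section Region

open scoped Matrix.Norms.Frobenius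

variable {B : Type*} [Fintype B]

/-! ## §1 The Hilbert–Schmidt window of a region at a live half-width: rate `N² − 1` assignment-free, ONE constant for the grid -/

/-- **THE `SU(N)` PIN AT A LIVE WINDOW, ALL `N`** (V29's `exists_abs_neg_log_pi_sball_sub_le` BY NAME at `νη`): for every `0 < ν₀ ≤ 1` there
is `c′ ≥ 0` such that for all `0 < η ≤ 2` and all `ν ∈ [ν₀, 1]` the live product window `Π_b SB (νη)` has positive mass and
`|−log κ(Π_b SB (νη)) − #bonds·(N² − 1)·log η⁻¹| ≤ #bonds·c′` — the rate `N² − 1 = dim SU(N)` is assignment-free, `c′ = c + (N² − 1)·log ν₀⁻¹`.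
[folklore] -/
theorem exists_abs_neg_log_pi_sball_sub_le_live {ν₀ : ℝ} (hν₀ : 0 < ν₀) (hν₀1 : ν₀ ≤ 1) :
    ∃ c' : ℝ, 0 ≤ c' ∧ ∀ η ν : ℝ, 0 < η → η ≤ 2 → ν₀ ≤ ν → ν ≤ 1 →
      0 < ((Measure.pi fun _ : B => haarProbability (Matrix.specialUnitaryGroup (Fin N) ℂ))
        (Set.univ.pi fun _ : B =>
          {V : Matrix.specialUnitaryGroup (Fin N) ℂ | ‖(V : Matrix (Fin N) (Fin N) ℂ) - 1‖ ≤ ν * η})).toReal ∧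
      |-Real.log ((Measure.pi fun _ : B => haarProbability (Matrix.specialUnitaryGroup (Fin N) ℂ))
        (Set.univ.pi fun _ : B =>
          {V : Matrix.specialUnitaryGroup (Fin N) ℂ | ‖(V : Matrix (Fin N) (Fin N) ℂ) - 1‖ ≤ ν * η})).toReal -
        (Fintype.card B : ℝ) * (((N ^ 2 - 1 : ℕ) : ℝ) * Real.log η⁻¹)| ≤
      (Fintype.card B : ℝ) * c' := by
  obtain ⟨c, hc, h⟩ := exists_abs_neg_log_pi_sball_sub_le (N := N) (B := B)
  have hlog : 0 ≤ Real.log ν₀⁻¹ := by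
    rw [Real.log_inv]; linarith [Real.log_nonpos hν₀.le hν₀1]
  refine ⟨c + ((N ^ 2 - 1 : ℕ) : ℝ) * Real.log ν₀⁻¹, by positivity, fun η ν hη hη2 hν hν1 => ?_⟩
  have hνpos : 0 < ν := hν₀.trans_le hν
  have hνη0 : 0 < ν * η := mul_pos hνpos hη
  have hνη2 : ν * η ≤ 2 := (mul_le_of_le_one_left hη.le hν1).trans hη2
  obtain ⟨hpos, habs⟩ := h (ν * η) hνη0 hνη2
  exact ⟨hpos, abs_pin_live (Nat.cast_nonneg _) (Nat.cast_nonneg _) hν₀ hν hν1 hη habs⟩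

/-- **THE `SU(N)` PRICE AT A LIVE WINDOW, ALL `N`**: for every `0 < ν₀ ≤ 1` ONE `c′ ≥ 0` with
`−log κ(Π_b SB (νη)) ≤ #bonds·((N² − 1)·log η⁻¹ + c′)` for all `0 < η ≤ 2`, `ν ∈ [ν₀, 1]` — the LOWER-bound use of the window: LOSS
`(N² − 1)·log ν₀⁻¹` per bond inside the constant, assignment-free. [folklore] -/
theorem exists_neg_log_pi_sball_le_sharp_live {ν₀ : ℝ} (hν₀ : 0 < ν₀) (hν₀1 : ν₀ ≤ 1) :
    ∃ c' : ℝ, 0 ≤ c' ∧ ∀ η ν : ℝ, 0 < η → η ≤ 2 → ν₀ ≤ ν → ν ≤ 1 →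
      0 < ((Measure.pi fun _ : B => haarProbability (Matrix.specialUnitaryGroup (Fin N) ℂ))
        (Set.univ.pi fun _ : B =>
          {V : Matrix.specialUnitaryGroup (Fin N) ℂ | ‖(V : Matrix (Fin N) (Fin N) ℂ) - 1‖ ≤ ν * η})).toReal ∧
      -Real.log ((Measure.pi fun _ : B => haarProbability (Matrix.specialUnitaryGroup (Fin N) ℂ))
        (Set.univ.pi fun _ : B =>
          {V : Matrix.specialUnitaryGroup (Fin N) ℂ | ‖(V : Matrix (Fin N) (Fin N) ℂ) - 1‖ ≤ ν * η})).toReal ≤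
      (Fintype.card B : ℝ) * (((N ^ 2 - 1 : ℕ) : ℝ) * Real.log η⁻¹ + c') := by
  obtain ⟨c', hc', h⟩ := exists_abs_neg_log_pi_sball_sub_le_live (N := N) (B := B) hν₀ hν₀1
  refine ⟨c', hc', fun η ν hη hη2 hν hν1 => ?_⟩
  obtain ⟨hpos, habs⟩ := h η ν hη hη2 hν hν1
  refine ⟨hpos, ?_⟩
  have := (abs_le.1 habs).2
  linarith

/-! ## §2 The trace (action) window of a region at a live threshold: print's rate `½d(𝔤) = ½(N² − 1)` assignment-free -/

/-- **THE TRACE-WINDOW PIN AT A LIVE THRESHOLD, ALL `N`** (V29's `exists_abs_neg_log_pi_traceWindow_sub_le` BY NAME at `νt`): for every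
`0 < ν₀ ≤ 1` ONE `c′ = c + ½(N² − 1)·log ν₀⁻¹ ≥ 0` with, for all `0 < t ≤ 2` and `ν ∈ [ν₀, 1]`: positive mass and
`|−log κ(Π_b {Re tr(1 − V_b) ≤ νt}) − #bonds·½(N² − 1)·log t⁻¹| ≤ #bonds·c′` — print's «`−½d(𝔤)log g_k⁻² + log σ₀`» ([Balaban1989LargeFieldII]
(1.10)) for `SU(N)`: the RATE survives road (δ), `σ₀` moves. [folklore] -/
theorem exists_abs_neg_log_pi_traceWindow_sub_le_live {ν₀ : ℝ} (hν₀ : 0 < ν₀) (hν₀1 : ν₀ ≤ 1) :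
    ∃ c' : ℝ, 0 ≤ c' ∧ ∀ t ν : ℝ, 0 < t → t ≤ 2 → ν₀ ≤ ν → ν ≤ 1 →
      0 < ((Measure.pi fun _ : B => haarProbability (Matrix.specialUnitaryGroup (Fin N) ℂ))
        (Set.univ.pi fun _ : B =>
          {V : Matrix.specialUnitaryGroup (Fin N) ℂ | (Matrix.trace (1 - (V : Matrix (Fin N) (Fin N) ℂ))).re ≤ ν * t})).toReal ∧
      |-Real.log ((Measure.pi fun _ : B => haarProbability (Matrix.specialUnitaryGroup (Fin N) ℂ))
        (Set.univ.pi fun _ : B =>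
          {V : Matrix.specialUnitaryGroup (Fin N) ℂ | (Matrix.trace (1 - (V : Matrix (Fin N) (Fin N) ℂ))).re ≤ ν * t})).toReal -
        (Fintype.card B : ℝ) * (((N ^ 2 - 1 : ℕ) : ℝ) / 2 * Real.log t⁻¹)| ≤
      (Fintype.card B : ℝ) * c' := by
  obtain ⟨c, hc, h⟩ := exists_abs_neg_log_pi_traceWindow_sub_le (N := N) (B := B)
  have hlog : 0 ≤ Real.log ν₀⁻¹ := by
    rw [Real.log_inv]; linarith [Real.log_nonpos hν₀.le hν₀1]
  refine ⟨c + ((N ^ 2 - 1 : ℕ) : ℝ) / 2 * Real.log ν₀⁻¹, by positivity, fun t ν ht ht2 hν hν1 => ?_⟩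
  have hνpos : 0 < ν := hν₀.trans_le hν
  have hνt0 : 0 < ν * t := mul_pos hνpos ht
  have hνt2 : ν * t ≤ 2 := (mul_le_of_le_one_left ht.le hν1).trans ht2
  obtain ⟨hpos, habs⟩ := h (ν * t) hνt0 hνt2
  exact ⟨hpos, abs_pin_live (Nat.cast_nonneg _) (by positivity) hν₀ hν hν1 ht habs⟩

end Region

/-! ## §3 Sanity -/

/-- For `N = 2` the trace-window rate is `3∕2` and the live constant shift `½(N² − 1)·log ν₀⁻¹` is file 27's `(3∕2)·log ν₀⁻¹`. -/
example (ν₀ : ℝ) : ((2 ^ 2 - 1 : ℕ) : ℝ) / 2 * Real.log ν₀⁻¹ = 3 / 2 * Real.log ν₀⁻¹ := by norm_num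

end Summit.QuantumFields.BalabanUV.T4Continuum.Spine.NE7c.LiveFactorWindowRateSUN

end
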